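/-
Copyright: seat `ym-line-cbag-p2` (prover-ym-line-cbag-p2-g0-0), route `ColdBoxAllGroups`, crux `BulkAllGroups`
(stmt-QuantumFields-22255), line `dlr-chessboard-G` (skeleton `Cruxes/BulkAllGroups/Lines/birth.lean`, v4).
-/
import Summits.QuantumFields.YangMills.Theorems.ColdBoxAllGroupsBulkAllGroupsBoxPolyFloorGOfBox
import Summits.QuantumFields.YangMills.Theorems.ColdBoxAllGroupsBoxFloorAllGroups

/-!
# Registered stub L4-G `stub_boxPolyFloorG` of crux `BulkAllGroups` (stmt-QuantumFields-22255), BY NAME — the polynomial box floor for every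
# compact simple `G`, from the PROVED sibling crux `BoxFloorAllGroups` (`BoxFloorAllGroups_proof`, p585759) + FLOOR

`stub_boxPolyFloorG`: for every compact simple `G` (any Borel structure), every `r : LatticeRep G`, there is `θk > 0` such that for `0 < θ ≤ θk`,
`BoxPolyFloorG r.ρ (θ/20) θ (2 + θ/2)` (the cold-wall covariance is eventually `≥ β^{−(2+θ/2)}`).  One line: the landed reduction
`stub_boxPolyFloorG_of_boxFloorAllGroups'` applied to `BoxFloorAllGroups_proof`.  NOT a claim about the mass gap; the Yang–Mills mass gap is NOT proved
by any of this (rung-level, RECORD label).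
-/

set_option autoImplicit false

noncomputable section

open Literature.MathematicalPhysics.QuantumFieldTheory
open Summit.QuantumFields.YangMills.Theorems.WeakCouplingRates

namespace Summit.QuantumFields.YangMills.Theorems.ColdBoxAllGroups

/-- **Registered stub `stub_boxPolyFloorG` (L4-G) of crux `stmt-QuantumFields-22255`**, by name and signature: from the proved sibling crux
`BoxFloorAllGroups` and the G-free FLOOR. [folklore] -/
theorem stub_boxPolyFloorG :
    ∀ (G : Type) [Group G] [TopologicalSpace G] [IsTopologicalGroup G] [CompactSpace G] [MeasurableSpace G] [BorelSpace G],
    IsCompactSimpleLieGroup G → ∀ r : LatticeRep G, ∃ θk : ℝ, 0 < θk ∧ ∀ θ : ℝ, 0 < θ → θ ≤ θk →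
      BoxPolyFloorG r.ρ (θ / 20) θ (2 + θ / 2) :=
  stub_boxPolyFloorG_of_boxFloorAllGroups' BoxFloorAllGroups_proof

end Summit.QuantumFields.YangMills.Theorems.ColdBoxAllGroups

end
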